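import Mathlib
import Literature.Analysis.FunctionSpaces.LatticeSobolev
import Literature.Analysis.FunctionSpaces.TorusLerayHelmholtzProofs
import Literature.Analysis.FunctionSpaces.TorusInverseLaplacianL2
import HarnessLib

/-!
# The Leray symbol is a contraction on every Fourier mode, hence on every weighted coefficient norm
# (lean g6, cell `ns-blowup`, 2026-08-26)

HONEST FRAMING (human ruling D-0035): nothing here is a claim about Navier–Stokes blow-up.
WHAT THIS IS NOT: not NS evidence — linear algebra in `ℂ^d` and a termwise comparison of `ℝ≥0∞`
lattice sums. Item (f) of the kernel form of the displayed constant `c_alg` of the R-β chain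
(`HOME/instab/C-ALG-DISPLAY.md` §2 (vi): "`ℙ` is a Fourier multiplier of matrix norm `≤ 1`, so
`‖ℙf‖_{H¹_κ} ≤ ‖f‖_{H¹_κ}`"; INSTAB-BRIDGE §13 (b)(ii)), handed to this seat in STATUS 07:53Z; companion
of `ConvectiveProductLawLattice` / `ConvectiveProductLawTorus` (instab g12) and
`ConvectiveProductLawBooking` (this seat).

On the frequency `k ∈ ℤ^d` the Leray–Helmholtz projection acts on a coefficient `z ∈ ℂ^d` by the
TRANSVERSAL PART `z − ((k·z)/|k|²) k` (Robinson–Rodrigo–Sadowski 2016, Thm. 2.6: `û_k = α_k k + w_k`,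
`w_k · k = 0`, `α_k = û_k·k/|k|²`; at `k = 0` the expression is `z` itself, Lean's `x / 0 = 0`, which is
the right value for the mean mode of `v − ∇Δ⁻¹ div v`). We prove:

* `inner_freqVec_lerayMode_eq_zero` — the transversal part is orthogonal to `k`;
* `norm_lerayMode_le` — **`‖z − ((k·z)/|k|²) k‖ ≤ ‖z‖`** (Pythagoras);
* `tsum_weight_mul_enorm_lerayMode_sq_le`, `eNormSq_lerayMode_le` — hence every weighted `ℓ²` sum of
  a coefficient family, in particular every lattice Sobolev norm `Lattice.eNormSq s` (and the
  `κ`-bracket sums of `ConvectiveProductLawBooking`), can only DECREASE under the modewise projection.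

The identification with the physical projector `v ↦ v − ∇Δ⁻¹ div v` on `T^d` (coefficientwise the map
above, `Torus.mFourierCoeff_complexify_gradient_apply_eq` / `Torus.mFourierCoeff_ofReal_divergence`) is
not restated here; its `L²`/`H¹` contraction in physical space is the tree's
`Torus.integral_norm_sq_sub_gradient_invLaplacian_divergence_le` /
`Torus.gradNormSq_sub_gradient_invLaplacian_divergence_le` (`TorusLerayHelmholtzH1`).

References: J. C. Robinson, J. L. Rodrigo, W. Sadowski, *The Three-Dimensional Navier–Stokes
Equations*, CUP 2016, Thm. 2.6 and Lemma 2.9 [RobinsonRodrigoSadowski2016]; C-ALG-DISPLAY.md §2 (vi).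
-/

noncomputable section

namespace Summit.NavierStokesRegularity.FluidComputer.ConvectiveProductLawLeray

open Literature.Analysis.FunctionSpaces Literature.Analysis.FunctionSpaces.Torus
open Literature.Analysis.FunctionSpaces.Lattice (eNormSq)
open scoped ENNReal NNReal InnerProductSpace ComplexConjugate BigOperators

variable {d : Type*} [Fintype d]

/-- The frequency `k ∈ ℤ^d` as a vector of `ℂ^d` has `‖k‖² = |k|²` (`Torus.freqNormSq`). -/
theorem norm_freqVec_sq (k : d → ℤ) :
    ‖(WithLp.toLp 2 (fun j => ((k j : ℤ) : ℂ)) : EuclideanSpace ℂ d)‖ ^ 2 = freqNormSq k := by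
  rw [EuclideanSpace.norm_sq_eq, freqNormSq]
  refine Finset.sum_congr rfl fun j _ => ?_
  simp [Complex.norm_intCast, sq_abs]

/-- `⟪k, z⟫_ℂ = ∑ⱼ kⱼ zⱼ` for the real frequency vector `k` (no conjugation survives). -/
theorem inner_freqVec_eq_sum (k : d → ℤ) (z : EuclideanSpace ℂ d) :
    inner ℂ (WithLp.toLp 2 (fun j => ((k j : ℤ) : ℂ)) : EuclideanSpace ℂ d) z =
      ∑ j, ((k j : ℤ) : ℂ) * z j := by
  rw [PiLp.inner_apply]
  refine Finset.sum_congr rfl fun j _ => ?_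
  simp [mul_comm]

/-- `⟪k, k⟫_ℂ = |k|²`. -/
theorem inner_freqVec_self (k : d → ℤ) :
    inner ℂ (WithLp.toLp 2 (fun j => ((k j : ℤ) : ℂ)) : EuclideanSpace ℂ d)
      (WithLp.toLp 2 (fun j => ((k j : ℤ) : ℂ)) : EuclideanSpace ℂ d) = (freqNormSq k : ℂ) := by
  rw [inner_freqVec_eq_sum, freqNormSq]
  push_cast
  refine Finset.sum_congr rfl fun j _ => ?_
  simp [sq]

/-- **The transversal part is orthogonal to the frequency**: `⟪k, z − ((k·z)/|k|²) k⟫ = 0`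
(Robinson–Rodrigo–Sadowski 2016, proof of Thm. 2.6: `w_k · k = 0`; at `k = 0` both sides vanish). -/
theorem inner_freqVec_lerayMode_eq_zero (k : d → ℤ) (z : EuclideanSpace ℂ d) :
    inner ℂ (WithLp.toLp 2 (fun j => ((k j : ℤ) : ℂ)) : EuclideanSpace ℂ d)
      (z - ((∑ j, ((k j : ℤ) : ℂ) * z j) / (freqNormSq k : ℂ)) •
        (WithLp.toLp 2 (fun j => ((k j : ℤ) : ℂ)) : EuclideanSpace ℂ d)) = 0 := by
  rcases eq_or_ne (freqNormSq k) 0 with h0 | h0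
  · have hk : k = 0 := by
      funext j
      have hj : (k j : ℝ) ^ 2 = 0 := by
        have hle : (k j : ℝ) ^ 2 ≤ freqNormSq k :=
          Finset.single_le_sum (f := fun i => (k i : ℝ) ^ 2) (fun i _ => sq_nonneg _) (Finset.mem_univ j)
        exact le_antisymm (by rw [h0] at hle; exact hle) (sq_nonneg _)
      exact_mod_cast pow_eq_zero_iff (n := 2) two_ne_zero |>.1 hj
    subst hk
    have hz0 : (WithLp.toLp 2 (fun j : d => (((0 : d → ℤ) j : ℤ) : ℂ)) : EuclideanSpace ℂ d) = 0 := by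
      ext j; simp
    rw [hz0, inner_zero_left]
  · have h1 : (freqNormSq k : ℂ) ≠ 0 := by exact_mod_cast h0
    rw [inner_sub_right, inner_smul_right, inner_freqVec_self, inner_freqVec_eq_sum,
      div_mul_cancel₀ _ h1, sub_self]

/-- **The Leray symbol contracts every mode**: `‖z − ((k·z)/|k|²) k‖ ≤ ‖z‖` for `z ∈ ℂ^d`, `k ∈ ℤ^d`
(Pythagoras: `z = w + α k` with `w ⊥ k`; C-ALG-DISPLAY §2 (vi): the multiplier of `ℙ` has matrix norm
`≤ 1`; Robinson–Rodrigo–Sadowski 2016, Thm. 2.6 / Lemma 2.9). -/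
theorem norm_lerayMode_le (k : d → ℤ) (z : EuclideanSpace ℂ d) :
    ‖z - ((∑ j, ((k j : ℤ) : ℂ) * z j) / (freqNormSq k : ℂ)) •
        (WithLp.toLp 2 (fun j => ((k j : ℤ) : ℂ)) : EuclideanSpace ℂ d)‖ ≤ ‖z‖ := by
  set K : EuclideanSpace ℂ d := WithLp.toLp 2 (fun j => ((k j : ℤ) : ℂ)) with hK
  set α : ℂ := (∑ j, ((k j : ℤ) : ℂ) * z j) / (freqNormSq k : ℂ) with hα
  set w : EuclideanSpace ℂ d := z - α • K with hw
  have horth : inner ℂ w (α • K) = 0 := by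
    rw [inner_smul_right, ← inner_conj_symm, inner_freqVec_lerayMode_eq_zero k z, map_zero, mul_zero]
  have hz : z = w + α • K := by rw [hw, sub_add_cancel]
  have hpy : ‖z‖ ^ 2 = ‖w‖ ^ 2 + ‖α • K‖ ^ 2 := by
    rw [hz, sq, sq, sq]
    exact norm_add_sq_eq_norm_sq_add_norm_sq_of_inner_eq_zero _ _ horth
  have hle : ‖w‖ ^ 2 ≤ ‖z‖ ^ 2 := by rw [hpy]; exact le_add_of_nonneg_right (sq_nonneg _)
  exact (sq_le_sq₀ (norm_nonneg _) (norm_nonneg _)).1 hle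

/-- **Every weighted `ℓ²` coefficient sum decreases under the modewise Leray projection**: for a
coefficient family `F : ℤ^d → ℂ^d` and any weight `ω : ℤ^d → [0, ∞]`,
`∑ₖ ω(k) ‖F(k) − ((k·F(k))/|k|²) k‖² ≤ ∑ₖ ω(k) ‖F(k)‖²` (in particular for the `κ`-brackets
`ω(k) = κ² + |k|²` of `ConvectiveProductLawBooking`: `‖ℙF‖_{H¹_κ} ≤ ‖F‖_{H¹_κ}`, C-ALG-DISPLAY §2 (vi)). -/
theorem tsum_weight_mul_enorm_lerayMode_sq_le (F : (d → ℤ) → EuclideanSpace ℂ d)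
    (ω : (d → ℤ) → ℝ≥0∞) :
    ∑' k : d → ℤ, ω k * ‖F k - ((∑ j, ((k j : ℤ) : ℂ) * F k j) / (freqNormSq k : ℂ)) •
        (WithLp.toLp 2 (fun j => ((k j : ℤ) : ℂ)) : EuclideanSpace ℂ d)‖ₑ ^ 2 ≤
      ∑' k : d → ℤ, ω k * ‖F k‖ₑ ^ 2 := by
  refine ENNReal.tsum_le_tsum fun k => ?_
  gcongr
  rw [← ofReal_norm, ← ofReal_norm]
  exact ENNReal.ofReal_le_ofReal (norm_lerayMode_le k (F k))

/-- **The modewise Leray projection is a contraction on every lattice Sobolev space `H_s`**: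
`‖ℙF‖²_{H_s} ≤ ‖F‖²_{H_s}` for `Lattice.eNormSq s` (`⟨k⟩ = (1+|k|²)^{1/2}`), every real `s`. -/
theorem eNormSq_lerayMode_le (s : ℝ) (F : (d → ℤ) → EuclideanSpace ℂ d) :
    eNormSq s (fun k => F k - ((∑ j, ((k j : ℤ) : ℂ) * F k j) / (freqNormSq k : ℂ)) •
        (WithLp.toLp 2 (fun j => ((k j : ℤ) : ℂ)) : EuclideanSpace ℂ d)) ≤ eNormSq s F :=
  tsum_weight_mul_enorm_lerayMode_sq_le F _

end Summit.NavierStokesRegularity.FluidComputer.ConvectiveProductLawLeray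

end

/-! ## Appendix (lean g6, 2026-08-26, second landing of this file — APPEND-ONLY): the physical
## Leray–Helmholtz projection `v ↦ v − ∇Δ⁻¹ div v` on `T^d` acts on Fourier
# coefficients by the modewise Leray symbol; hence it contracts every weighted coefficient norm
# (lean g6, cell `ns-blowup`, 2026-08-26)

HONEST FRAMING (human ruling D-0035): nothing here is a claim about Navier–Stokes blow-up.
WHAT THIS IS NOT: not NS evidence — a dictionary between the tree's smooth Leray–Helmholtz
projection (`TorusLerayHelmholtzH1`: the honest operator `P v = v − ∇Δ⁻¹(div v)`, written expanded)
and the modewise symbol of `ConvectiveProductLawLeray` (`z ↦ z − ((k·z)/|k|²) k`), plus the resulting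
contraction of every weighted `ℓ²` coefficient sum. It closes item (f) of the kernel form of the
displayed constant `c_alg` (`HOME/instab/C-ALG-DISPLAY.md` §2 (vi): «`ℙ` is a Fourier multiplier of
matrix norm `≤ 1`, so `‖ℙf‖_{H¹_κ} ≤ ‖f‖_{H¹_κ}`»; INSTAB-BRIDGE §13 (b)(ii)) at the level of the
PHYSICAL projector, so that the booking sentence of `ConvectiveProductLawBooking` holds verbatim
for `ℙ[(u·∇)v]` in place of `(u·∇)v`.

* `mFourierCoeff_leray_eq_lerayMode` — for smooth real `v` on `T^d`,
  `𝓕(ℂ∘(v − ∇Δ⁻¹div v))(k) = v̂(k) − ((k·v̂(k))/|k|²) k`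
  (composition of the tree's `Torus.mFourierCoeff_complexify_gradient_apply_eq`,
  `Torus.mFourierCoeff_ofReal_invLaplacian` (multiplier `(−4π²|k|²)⁻¹`, `0` at `k = 0`) and
  `Torus.mFourierCoeff_ofReal_divergence`: `(2πi)² kⱼ (−4π²|k|²)⁻¹ (k·v̂) = kⱼ (k·v̂)/|k|²`;
  Robinson–Rodrigo–Sadowski 2016, Thm. 2.6 / Def. 2.8).
* `enorm_mFourierCoeff_leray_le` — `‖𝓕(ℂ∘P v)(k)‖ ≤ ‖𝓕(ℂ∘v)(k)‖` on every mode;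
* `tsum_weight_mul_enorm_mFourierCoeff_leray_sq_le` — for every weight `ω : ℤ^d → [0, ∞]`,
  `∑ₖ ω(k) ‖𝓕(ℂ∘P v)(k)‖² ≤ ∑ₖ ω(k) ‖𝓕(ℂ∘v)(k)‖²` (in particular the `κ`-bracket sums
  `ω(k) = κ² + |k|²` and the tree's `Lattice.eNormSq s`).

References: J. C. Robinson, J. L. Rodrigo, W. Sadowski, *The Three-Dimensional Navier–Stokes
Equations*, CUP 2016, Thm. 2.6, Def. 2.8, Lemma 2.9 [RobinsonRodrigoSadowski2016]; C-ALG-DISPLAY.md §2 (vi).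
-/

noncomputable section

namespace Summit.NavierStokesRegularity.FluidComputer.ConvectiveProductLawLeray

open MeasureTheory UnitAddTorus Function Finset
open Literature.Analysis.FunctionSpaces Literature.Analysis.FunctionSpaces.Torus
open scoped ENNReal NNReal InnerProductSpace ComplexConjugate BigOperators

variable {d : Type*} [Fintype d] [DecidableEq d] [Nonempty d]
variable {v : UnitAddTorus d → EuclideanSpace ℝ d}

omit [DecidableEq d] [Nonempty d] in
/-- The scalar multiplier of `∇Δ⁻¹div` on one mode:
`(2πi kⱼ) · m(k) · (2πi) = kⱼ / |k|²` with `m(k) = (−4π²|k|²)⁻¹` (`k ≠ 0`), and `0` at `k = 0`; in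
Lean's field conventions both sides read `kⱼ / |k|²` with `x / 0 = 0`. -/
theorem gradient_invLaplacian_divergence_multiplier (k : d → ℤ) (j : d) :
    2 * (Real.pi : ℂ) * Complex.I * (k j : ℂ) * (invLaplacianMultiplier k * (2 * Real.pi * Complex.I)) =
      ((k j : ℤ) : ℂ) / (freqNormSq k : ℂ) := by
  by_cases hk : k = 0
  · subst hk
    simp [invLaplacianMultiplier]
  · have hfs : (freqNormSq k : ℂ) ≠ 0 := by
      have h0 : freqNormSq k ≠ 0 := fun h => hk (eq_zero_of_freqNormSq_eq_zero h)
      exact_mod_cast h0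
    have hpi : (Real.pi : ℂ) ≠ 0 := by exact_mod_cast Real.pi_ne_zero
    rw [invLaplacianMultiplier, if_neg hk]
    push_cast
    field_simp
    ring_nf
    rw [Complex.I_sq]
    ring

/-- **The physical Leray–Helmholtz projection acts modewise by the Leray symbol**: for a smooth
real vector field `v` on `T^d`,
`𝓕(ℂ∘(v − ∇Δ⁻¹div v))(k) = v̂(k) − ((k·v̂(k))/|k|²) k`, `v̂ = 𝓕(ℂ∘v)` (Robinson–Rodrigo–Sadowski
2016, Thm. 2.6 / Def. 2.8: `ℙu = ∑ (û_k − (û_k·k/|k|²) k) e^{ik·x}`; the mean mode is kept). -/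
theorem mFourierCoeff_leray_eq_lerayMode (hv : IsSmooth v) (k : d → ℤ) :
    mFourierCoeff (EuclideanSpace.complexify ∘
        fun x => v x - Torus.gradient (invLaplacian (divergence v)) x) k =
      mFourierCoeff (EuclideanSpace.complexify ∘ v) k -
        ((∑ j, ((k j : ℤ) : ℂ) * mFourierCoeff (EuclideanSpace.complexify ∘ v) k j) /
            (freqNormSq k : ℂ)) •
          (WithLp.toLp 2 (fun j => ((k j : ℤ) : ℂ)) : EuclideanSpace ℂ d) := by
  have hdiv : IsSmooth (divergence v) := hv.divergence
  have hψ : IsSmooth (invLaplacian (divergence v)) := isSmooth_invLaplacian hdiv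
  have hg : IsSmooth (Torus.gradient (invLaplacian (divergence v))) := hψ.gradient
  -- complexification is linear: split the difference
  have hsplit : (EuclideanSpace.complexify ∘ fun x => v x - Torus.gradient (invLaplacian (divergence v)) x) =
      (EuclideanSpace.complexify ∘ v) - (EuclideanSpace.complexify ∘ Torus.gradient (invLaplacian (divergence v))) := by
    funext x
    simp only [Function.comp_apply, Pi.sub_apply, map_sub]
  rw [hsplit, mFourierCoeff_sub hv.complexify_comp.integrable hg.complexify_comp.integrable]
  congr 1
  -- the gradient part, coordinatewise
  ext j
  rw [mFourierCoeff_complexify_gradient_apply_eq hψ k j, mFourierCoeff_ofReal_invLaplacian hdiv k,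
    mFourierCoeff_ofReal_divergence hv k]
  simp only [PiLp.smul_apply, smul_eq_mul]
  linear_combination (∑ x, ((k x : ℤ) : ℂ) * mFourierCoeff (EuclideanSpace.complexify ∘ v) k x) *
    gradient_invLaplacian_divergence_multiplier k j

/-- **The Leray–Helmholtz projection contracts every Fourier mode**:
`‖𝓕(ℂ∘(v − ∇Δ⁻¹div v))(k)‖ₑ ≤ ‖𝓕(ℂ∘v)(k)‖ₑ` (C-ALG-DISPLAY §2 (vi); Robinson–Rodrigo–Sadowski
2016, Thm. 2.6: `|û_k|² = |α_k k|² + |w_k|²`). -/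
theorem enorm_mFourierCoeff_leray_le (hv : IsSmooth v) (k : d → ℤ) :
    ‖mFourierCoeff (EuclideanSpace.complexify ∘
        fun x => v x - Torus.gradient (invLaplacian (divergence v)) x) k‖ₑ ≤
      ‖mFourierCoeff (EuclideanSpace.complexify ∘ v) k‖ₑ := by
  rw [mFourierCoeff_leray_eq_lerayMode hv k, ← ofReal_norm, ← ofReal_norm]
  exact ENNReal.ofReal_le_ofReal (norm_lerayMode_le k _)

/-- **Every weighted `ℓ²` coefficient sum decreases under the Leray–Helmholtz projection**: for
smooth real `v` on `T^d` and any weight `ω : ℤ^d → [0, ∞]`,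
`∑ₖ ω(k) ‖𝓕(ℂ∘(v − ∇Δ⁻¹div v))(k)‖² ≤ ∑ₖ ω(k) ‖𝓕(ℂ∘v)(k)‖²` — with `ω(k) = κ² + |k|²` this is
`‖ℙf‖_{H¹_κ} ≤ ‖f‖_{H¹_κ}` of C-ALG-DISPLAY §2 (vi), so the booking bound of
`ConvectiveProductLawBooking.kappaWeight_tsum_sq_mFourierCoeff_convect_le` holds for `ℙ[(u·∇)v]`. -/
theorem tsum_weight_mul_enorm_mFourierCoeff_leray_sq_le (hv : IsSmooth v) (ω : (d → ℤ) → ℝ≥0∞) :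
    ∑' k : d → ℤ, ω k * ‖mFourierCoeff (EuclideanSpace.complexify ∘
        fun x => v x - Torus.gradient (invLaplacian (divergence v)) x) k‖ₑ ^ 2 ≤
      ∑' k : d → ℤ, ω k * ‖mFourierCoeff (EuclideanSpace.complexify ∘ v) k‖ₑ ^ 2 := by
  refine ENNReal.tsum_le_tsum fun k => ?_
  gcongr
  exact enorm_mFourierCoeff_leray_le hv k

/-- **The Leray–Helmholtz projection is a contraction on every `H_s` of the tree's lattice scale**
(`Lattice.eNormSq s`, `⟨k⟩ = (1+|k|²)^{1/2}`): `‖ℙv‖²_{H_s} ≤ ‖v‖²_{H_s}` for smooth real `v`. -/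
theorem eNormSq_mFourierCoeff_leray_le (hv : IsSmooth v) (s : ℝ) :
    Lattice.eNormSq s (mFourierCoeff (EuclideanSpace.complexify ∘
        fun x => v x - Torus.gradient (invLaplacian (divergence v)) x)) ≤
      Lattice.eNormSq s (mFourierCoeff (EuclideanSpace.complexify ∘ v)) :=
  tsum_weight_mul_enorm_mFourierCoeff_leray_sq_le hv _

end Summit.NavierStokesRegularity.FluidComputer.ConvectiveProductLawLeray

end
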